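import Summits.QuantumFields.YangMills.Theorems.SwapVirialDeficitZeroModeGroupThreeSmallBallRateCoupled
import HarnessLib

/-!
# Exact zero-mode rung Z4 in SMALL-BALL form — VII-c: every flip lies in a layer; the per-hub bound `(vol⊗vol)(G_s(a) Δ G₀(a)) ≤ (√s/r⁶)·K`
# (LEAD ym-line-sfw-p2 g93 07:46Z «`Haar³{N₃(t)} = v₃t⁴(1 + O(t^θ))`»; free-hands support of ⟨stmt-QuantumFields-24197⟩)

* §16 `transverse_lt`, `window_mem_of_constraints` (either system of constraints puts the projected point in the window), `flipM_le`
  (`X + Y + 4XY ≤ r⁻⁴`), `coupled_layer_of_abs`; ★★ `pairCoord_mem_layers` — for an axis hub (`a_J = a_K = 0`, `r = a_I > 0`, `‖a‖ ≤ 1`) and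
  `0 < s ≤ 1`, every point of `G_s(a) Δ G₀(a)` has pair coordinates in `layerBX ∪ layerHX ∪ layerBY ∪ layerHY ∪ layerC ∪ {y₀²+y_I² = 0}`
  (ten flips: two impossible by monotonicity, two more contradict the other system, the rest are the five layers); `volume_nullPiece`;
  ★★ `volume_symmDiff_rescaledSet_le` — `(vol⊗vol)(G_s(a) Δ G₀(a)) ≤ ofReal(√s/a_I⁶)·(64 + 4√2·Ising(¼)²)` (✓`measurePreserving_pairCoord`).
Part VIII: hub integrals (polar cap by w2's ✓`lintegral_dominator_le`, bulk by `r⁻⁶`) and the rate `|Haar³(N₃(t))/t⁴ − v₃′| ≤ K·t^{1/10}`.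
HONEST LABEL: finite-dimensional measure theory (plan-level zero-mode rung of a DRAFT line); NOT ⟨24197⟩; the Yang–Mills mass gap is NOT proved; no summit
is proved by a line.  Seat ym-line-fcl-p3 g44, `--supports stmt-QuantumFields-24197`.  THEOREMS ONLY, standard axioms.
References: [cite: GonzalezarroyoAltes1988]; [cite: Vanbaal2001]; [folklore].
-/

set_option autoImplicit false

noncomputable section

open MeasureTheory Quaternion Set Filter Topology
open scoped Quaternion ENNReal BigOperators Topology
open Literature.MathematicalPhysics.QuantumLattice
open Summit.QuantumFields.YangMills.Theorems.SwapTwistDeficit.ToronLog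

attribute [local instance] Literature.Analysis.FluidPDE.Tao2016.quatMeasurableSpace
  Literature.Analysis.FluidPDE.Tao2016.quatBorelSpace
  Literature.MathematicalPhysics.QuantumLattice.secondCountableTopology_su2

namespace Summit.QuantumFields.YangMills.Theorems.SwapVirialDeficit.ZeroModeGroup
/-! ## §16 Every flip lies in a layer; the per-hub bound -/

/-- Transverse confinement: `4r²X ≤ Nρ²`, `N < 1`, `ρ² ≤ 1`, `r > 0`, `0 ≤ N` ⇒ `X < 1/(4r²)`. [folklore] -/
theorem transverse_lt {r ρsq N X : ℝ} (hr : 0 < r) (hN : N < 1) (hρ : ρsq ≤ 1) (hρ0 : 0 ≤ ρsq)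
    (h : 4 * (r ^ 2 * X) ≤ N * ρsq) : X < 1 / (4 * r ^ 2) := by
  rw [lt_div_iff₀ (by positivity)]
  have h1 : N * ρsq ≤ 1 * ρsq := mul_le_mul_of_nonneg_right hN.le hρ0
  nlinarith [h1]

/-- Window membership from either system of constraints. [folklore] -/
theorem window_mem_of_constraints {r ρsq s : ℝ} (hr : 0 < r) (hρ : ρsq ≤ 1) (hρ0 : 0 ≤ ρsq) (hs : 0 ≤ s) {x y : ℍ}
    (h1 : dilNormSq s x < 1) (h2 : dilNormSq s y < 1)
    (h3 : 4 * (r ^ 2 * (x.imJ ^ 2 + x.imK ^ 2)) ≤ dilNormSq s x * ρsq) (h4 : 4 * (r ^ 2 * (y.imJ ^ 2 + y.imK ^ 2)) ≤ dilNormSq s y * ρsq) :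
    (y.re, ((x.imI, y.imI), ((x.imJ, y.imJ), (x.imK, y.imK)))) ∈ window r ∧ (x.re, ((x.imI, y.imI), ((x.imJ, y.imJ), (x.imK, y.imK)))) ∈ window r := by
  have hX := transverse_lt hr h1 hρ hρ0 h3
  have hY := transverse_lt hr h2 hρ hρ0 h4
  unfold dilNormSq at h1 h2
  have hsx : 0 ≤ s * (x.imJ ^ 2 + x.imK ^ 2) := by positivity
  have hsy : 0 ≤ s * (y.imJ ^ 2 + y.imK ^ 2) := by positivity
  have e1 : x.re ^ 2 < 1 := by nlinarith [sq_nonneg x.imI]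
  have e2 : y.re ^ 2 < 1 := by nlinarith [sq_nonneg y.imI]
  have e3 : x.imI ^ 2 < 1 := by nlinarith [sq_nonneg x.re]
  have e4 : y.imI ^ 2 < 1 := by nlinarith [sq_nonneg y.re]
  have e5 : x.imJ ^ 2 < 1 / (4 * r ^ 2) := by nlinarith [sq_nonneg x.imK]
  have e6 : x.imK ^ 2 < 1 / (4 * r ^ 2) := by nlinarith [sq_nonneg x.imJ]
  have e7 : y.imJ ^ 2 < 1 / (4 * r ^ 2) := by nlinarith [sq_nonneg y.imK]
  have e8 : y.imK ^ 2 < 1 / (4 * r ^ 2) := by nlinarith [sq_nonneg y.imJ]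
  simp only [window, Set.mem_prod, Set.mem_setOf_eq]
  exact ⟨⟨e2, ⟨e3, e4⟩, ⟨e5, e7⟩, ⟨e6, e8⟩⟩, ⟨e1, ⟨e3, e4⟩, ⟨e5, e7⟩, ⟨e6, e8⟩⟩⟩

/-- `dilNormSq s x = dilNormSq 0 x + s·(x_J² + x_K²)`. [folklore] -/
theorem dilNormSq_eq_add (s : ℝ) (x : ℍ) : dilNormSq s x = dilNormSq 0 x + s * (x.imJ ^ 2 + x.imK ^ 2) := by
  unfold dilNormSq; ring

/-- The flip size of the coupled constraint: `X + Y + 4XY ≤ r⁻⁴` when `X, Y < 1/(4r²)`, `0 < r ≤ 1`. [folklore] -/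
theorem flipM_le {r X Y : ℝ} (hr : 0 < r) (hr1 : r ≤ 1) (hX : X < 1 / (4 * r ^ 2)) (hY0 : 0 ≤ Y) (hY : Y < 1 / (4 * r ^ 2)) :
    X + Y + 4 * (X * Y) ≤ (r ^ 4)⁻¹ := by
  have hr2 : 0 < r ^ 2 := by positivity
  have h14 : 1 / (4 * r ^ 2) ≤ 1 / (4 * r ^ 4) := by
    apply one_div_le_one_div_of_le (by positivity); nlinarith [mul_le_mul hr1 hr1 hr.le zero_le_one, sq_nonneg r]
  have hXY : X * Y ≤ 1 / (4 * r ^ 2) * (1 / (4 * r ^ 2)) := mul_le_mul hX.le hY.le hY0 (by positivity)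
  have e : 1 / (4 * r ^ 4) + 1 / (4 * r ^ 4) + 4 * (1 / (4 * r ^ 2) * (1 / (4 * r ^ 2))) = 3 / (4 * r ^ 4) := by field_simp; ring
  have h34 : 3 / (4 * r ^ 4) ≤ (r ^ 4)⁻¹ := by rw [div_le_iff₀ (by positivity), inv_mul_eq_div, le_div_iff₀ (by positivity)]; nlinarith [pow_pos hr 4]
  nlinarith

/-- From the coupled flip estimate to the coupled layer (or the null set): shared tail of both directions. [folklore] -/
theorem coupled_layer_of_abs {r s N x0 xI P : ℝ} (hN0 : 0 ≤ N)
    (habs : |4 * P - (x0 ^ 2 + xI ^ 2) * N| ≤ s * (r ^ 4)⁻¹) :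
    N = 0 ∨ (0 < N ∧ 4 * P / N - s * (r ^ 4)⁻¹ / N - xI ^ 2 ≤ x0 ^ 2 ∧
      x0 ^ 2 ≤ 4 * P / N - s * (r ^ 4)⁻¹ / N - xI ^ 2 + 2 * (s * (r ^ 4)⁻¹) / N) := by
  rcases hN0.eq_or_lt with hN | hN
  · exact Or.inl hN.symm
  · right
    refine ⟨hN, ?_⟩
    have h' : |N * x0 ^ 2 - (4 * P - xI ^ 2 * N)| ≤ s * (r ^ 4)⁻¹ := by
      rw [show N * x0 ^ 2 - (4 * P - xI ^ 2 * N) = -(4 * P - (x0 ^ 2 + xI ^ 2) * N) by ring, abs_neg]; exact habs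
    have hl := sq_mem_layer_of_abs_le hN h'
    have e : (4 * P - xI ^ 2 * N) / N = 4 * P / N - xI ^ 2 := by field_simp
    rw [e] at hl
    constructor <;> linarith [hl.1, hl.2]

/-- ★★ **Every flip lies in a layer.**  For an axis hub (`a_J = a_K = 0`, `r = a_I > 0`, `‖a‖ ≤ 1`) and `0 < s ≤ 1`, a point of
`G_s(a) Δ G₀(a)` has pair coordinates in one of the five layers or in the null set `{y₀² + y_I² = 0}`. [folklore] -/
theorem pairCoord_mem_layers {a : ℍ} (hJ : a.imJ = 0) (hK : a.imK = 0) (hr : 0 < a.imI) (ha1 : ‖a‖ ≤ 1) {s : ℝ} (hs0 : 0 < s) (hs1 : s ≤ 1)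
    {x y : ℍ} (h : ((x, y) ∈ rescaledSet s a ∧ (x, y) ∉ rescaledSet 0 a) ∨ ((x, y) ∈ rescaledSet 0 a ∧ (x, y) ∉ rescaledSet s a)) :
    pairCoord (x, y) ∈ layerBX a.imI s ∪ layerHX a.imI ‖a‖ s ∪ layerBY a.imI s ∪ layerHY a.imI ‖a‖ s ∪ layerC a.imI s ∪
      {p : (ℝ × ℝ) × ((ℝ × ℝ) × ((ℝ × ℝ) × (ℝ × ℝ))) | p.1.2 ^ 2 + p.2.1.2 ^ 2 = 0} := by
  -- hub data
  have hnorm : ‖a‖ ^ 2 = a.re ^ 2 + a.imI ^ 2 := by rw [sq_norm_eq_sum_sq, hJ, hK]; ring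
  have hρ2 : 0 < ‖a‖ ^ 2 := by rw [hnorm]; positivity
  have hρ1 : ‖a‖ ^ 2 ≤ 1 := by nlinarith [norm_nonneg a]
  have hr1 : a.imI ≤ 1 := by nlinarith [norm_nonneg a]
  -- shorthand facts
  have hX0 : 0 ≤ x.imJ ^ 2 + x.imK ^ 2 := by positivity
  have hY0 : 0 ≤ y.imJ ^ 2 + y.imK ^ 2 := by positivity
  have hNx0 : 0 ≤ dilNormSq 0 x := dilNormSq_nonneg le_rfl x
  have hNy0 : 0 ≤ dilNormSq 0 y := dilNormSq_nonneg le_rfl y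
  have eNx := dilNormSq_eq_add s x
  have eNy := dilNormSq_eq_add s y
  have eNx0 := dilNormSq_zero x
  have eNy0 := dilNormSq_zero y
  have hQ : (x.imJ * y.imK - x.imK * y.imJ) ^ 2 ≤ (x.imJ ^ 2 + x.imK ^ 2) * (y.imJ ^ 2 + y.imK ^ 2) := by
    nlinarith [sq_nonneg (x.imJ * y.imJ + x.imK * y.imK)]
  -- the goal in coordinates
  simp only [Set.mem_union, Set.mem_setOf_eq, layerBX, layerHX, layerBY, layerHY, layerC, pairCoord, xT, yT, pC]
  simp only [rescaledSet, Set.mem_setOf_eq, not_and_or, not_lt, not_le, zero_mul, add_zero] at h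
  rcases h with ⟨⟨s1, s2, s3, s4, s5⟩, hN0⟩ | ⟨⟨d1, d2, d3, d4, d5⟩, hNS⟩
  · -- in `G_s`, not in `G₀`
    have hw := window_mem_of_constraints hr hρ1 hρ2.le hs0.le s1 s2 s3 s4
    have hXlt := transverse_lt hr s1 hρ1 hρ2.le s3
    have hYlt := transverse_lt hr s2 hρ1 hρ2.le s4
    rcases hN0 with n1 | n2 | n3 | n4 | n5
    · exfalso; rw [eNx] at s1; linarith only [s1, n1, mul_nonneg hs0.le hX0]
    · exfalso; rw [eNy] at s2; linarith only [s2, n2, mul_nonneg hs0.le hY0]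
    · -- hub-x flip
      left; left; left; left; right
      refine ⟨hw.1, ?_, ?_⟩
      · rw [eNx, eNx0] at s3
        have h1 : 4 * a.imI ^ 2 * (x.imJ ^ 2 + x.imK ^ 2) / ‖a‖ ^ 2 ≤ x.re ^ 2 + x.imI ^ 2 + s * (x.imJ ^ 2 + x.imK ^ 2) := by
          rw [div_le_iff₀ hρ2]; linarith only [s3]
        linarith only [h1]
      · rw [eNx0] at n3
        have h2 : x.re ^ 2 + x.imI ^ 2 ≤ 4 * a.imI ^ 2 * (x.imJ ^ 2 + x.imK ^ 2) / ‖a‖ ^ 2 := by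
          rw [le_div_iff₀ hρ2]; linarith only [n3]
        linarith only [h2]
    · -- hub-y flip
      left; left; right
      refine ⟨hw.2, ?_, ?_⟩
      · rw [eNy, eNy0] at s4
        have h1 : 4 * a.imI ^ 2 * (y.imJ ^ 2 + y.imK ^ 2) / ‖a‖ ^ 2 ≤ y.re ^ 2 + y.imI ^ 2 + s * (y.imJ ^ 2 + y.imK ^ 2) := by
          rw [div_le_iff₀ hρ2]; linarith only [s4]
        linarith only [h1]
      · rw [eNy0] at n4
        have h2 : y.re ^ 2 + y.imI ^ 2 ≤ 4 * a.imI ^ 2 * (y.imJ ^ 2 + y.imK ^ 2) / ‖a‖ ^ 2 := by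
          rw [le_div_iff₀ hρ2]; linarith only [n4]
        linarith only [h2]
    · -- coupled flip
      rw [eNx, eNy] at s5
      have hd1 : dilNormSq 0 x ≤ 1 := by rw [eNx] at s1; linarith only [s1, mul_nonneg hs0.le hX0]
      have hd2 : dilNormSq 0 y ≤ 1 := by rw [eNy] at s2; linarith only [s2, mul_nonneg hs0.le hY0]
      have habs := coupled_flip_pos hs0.le hs1 (sq_nonneg (x.imJ * y.imK - x.imK * y.imJ)) hX0 hY0 hd1 hd2 s5 (not_le.2 n5)
      have hM := flipM_le hr hr1 hXlt hY0 hYlt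
      rw [eNx0] at habs
      have habs' := habs.trans (mul_le_mul_of_nonneg_left hM hs0.le)
      rw [eNy0] at habs' hNy0
      rcases coupled_layer_of_abs hNy0 habs' with hnull | ⟨hpos, hl, hu⟩
      · right; exact hnull
      · left; right; exact ⟨hw.1, hpos, hl, hu⟩
  · -- in `G₀`, not in `G_s`
    have hw := window_mem_of_constraints hr hρ1 hρ2.le le_rfl d1 d2 d3 d4
    have hXlt := transverse_lt hr d1 hρ1 hρ2.le d3
    have hYlt := transverse_lt hr d2 hρ1 hρ2.le d4
    rcases hNS with m1 | m2 | m3 | m4 | m5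
    · -- ball-x flip
      left; left; left; left; left
      rw [eNx, eNx0] at m1; rw [eNx0] at d1
      exact ⟨hw.1, by linarith only [m1], by linarith only [d1]⟩
    · -- ball-y flip
      left; left; left; right
      rw [eNy, eNy0] at m2; rw [eNy0] at d2
      exact ⟨hw.2, by linarith only [m2], by linarith only [d2]⟩
    · exfalso; rw [eNx] at m3; linarith only [m3, d3, mul_nonneg (mul_nonneg hs0.le hX0) hρ2.le]
    · exfalso; rw [eNy] at m4; linarith only [m4, d4, mul_nonneg (mul_nonneg hs0.le hY0) hρ2.le]
    · -- coupled flip, other direction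
      rw [eNx, eNy] at m5
      have habs := coupled_flip_neg hs0.le hQ hX0 hY0 hNx0 hNy0 d5 (not_le.2 m5)
      have hM := flipM_le hr hr1 hXlt hY0 hYlt
      rw [eNx0] at habs
      have habs' := habs.trans (mul_le_mul_of_nonneg_left hM hs0.le)
      rw [eNy0] at habs' hNy0
      rcases coupled_layer_of_abs hNy0 habs' with hnull | ⟨hpos, hl, hu⟩
      · right; exact hnull
      · left; right; exact ⟨hw.1, hpos, hl, hu⟩


/-- The exceptional set `{y₀² + y_I² = 0}` of the pair coordinates is Lebesgue-null. [folklore] -/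
theorem volume_nullPiece : (volume : Measure ((ℝ × ℝ) × ((ℝ × ℝ) × ((ℝ × ℝ) × (ℝ × ℝ)))))
    {p | p.1.2 ^ 2 + p.2.1.2 ^ 2 = 0} = 0 := by
  have hsub : {p : (ℝ × ℝ) × ((ℝ × ℝ) × ((ℝ × ℝ) × (ℝ × ℝ))) | p.1.2 ^ 2 + p.2.1.2 ^ 2 = 0} ⊆ (Set.univ ×ˢ {0}) ×ˢ Set.univ := by
    intro p hp
    simp only [Set.mem_setOf_eq] at hp
    have h0 : p.1.2 = 0 := by nlinarith [sq_nonneg p.1.2, sq_nonneg p.2.1.2]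
    simp [Set.mem_prod, h0]
  refine measure_mono_null hsub ?_
  simp only [Measure.volume_eq_prod, Measure.prod_prod, Real.volume_singleton, mul_zero, zero_mul]

/-- ENNReal bookkeeping: `4·[(2√s/r)(8/r⁴)] + (2√2√s/r²)·I·(2I)·r⁻⁴ ≤ (√s/r⁶)·(64 + 4√2·I²)` for `0 < r ≤ 1`. [folklore] -/
theorem layer_sum_le {r s : ℝ} (hr : 0 < r) (hr1 : r ≤ 1) (I : ℝ≥0∞) :
    4 * (ENNReal.ofReal (2 * Real.sqrt s / r) * ENNReal.ofReal (8 / r ^ 4)) +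
      ENNReal.ofReal (2 * Real.sqrt 2 * Real.sqrt s / r ^ 2) * (I * ((2 * I) * ENNReal.ofReal (1 / r ^ 4))) ≤
      ENNReal.ofReal (Real.sqrt s / r ^ 6) * (ENNReal.ofReal 64 + ENNReal.ofReal (4 * Real.sqrt 2) * (I * I)) := by
  have hs' := Real.sqrt_nonneg s
  -- the four ball/hub layers
  have h1 : 4 * (ENNReal.ofReal (2 * Real.sqrt s / r) * ENNReal.ofReal (8 / r ^ 4)) ≤ ENNReal.ofReal (Real.sqrt s / r ^ 6) * ENNReal.ofReal 64 := by
    rw [show (4 : ℝ≥0∞) = ENNReal.ofReal 4 by simp, ← ENNReal.ofReal_mul (by positivity), ← ENNReal.ofReal_mul (by norm_num),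
      ← ENNReal.ofReal_mul (by positivity)]
    refine ENNReal.ofReal_le_ofReal ?_
    rw [show (4 : ℝ) * (2 * Real.sqrt s / r * (8 / r ^ 4)) = 64 * Real.sqrt s / r ^ 5 by field_simp; ring,
      show Real.sqrt s / r ^ 6 * 64 = 64 * Real.sqrt s / r ^ 6 by ring]
    rw [div_le_div_iff₀ (by positivity) (by positivity)]
    have : r ^ 6 ≤ r ^ 5 := by
      calc r ^ 6 = r ^ 5 * r := by ring
        _ ≤ r ^ 5 * 1 := mul_le_mul_of_nonneg_left hr1 (by positivity)
        _ = r ^ 5 := by ring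
    nlinarith [mul_nonneg (by norm_num : (0 : ℝ) ≤ 64) hs']
  -- the coupled layer (an equality)
  have h2 : ENNReal.ofReal (2 * Real.sqrt 2 * Real.sqrt s / r ^ 2) * (I * ((2 * I) * ENNReal.ofReal (1 / r ^ 4))) =
      ENNReal.ofReal (Real.sqrt s / r ^ 6) * (ENNReal.ofReal (4 * Real.sqrt 2) * (I * I)) := by
    rw [show (2 : ℝ≥0∞) = ENNReal.ofReal 2 by simp]
    have e : ENNReal.ofReal (2 * Real.sqrt 2 * Real.sqrt s / r ^ 2) * ENNReal.ofReal 2 * ENNReal.ofReal (1 / r ^ 4) =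
        ENNReal.ofReal (Real.sqrt s / r ^ 6) * ENNReal.ofReal (4 * Real.sqrt 2) := by
      rw [← ENNReal.ofReal_mul (by positivity), ← ENNReal.ofReal_mul (by positivity), ← ENNReal.ofReal_mul (by positivity)]
      congr 1; field_simp; ring
    calc ENNReal.ofReal (2 * Real.sqrt 2 * Real.sqrt s / r ^ 2) * (I * ((ENNReal.ofReal 2 * I) * ENNReal.ofReal (1 / r ^ 4)))
        = (ENNReal.ofReal (2 * Real.sqrt 2 * Real.sqrt s / r ^ 2) * ENNReal.ofReal 2 * ENNReal.ofReal (1 / r ^ 4)) * (I * I) := by ring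
      _ = _ := by rw [e]; ring
  rw [h2, mul_add]
  exact add_le_add h1 le_rfl

/-- ★★ **THE PER-HUB BOUND**: for an axis hub (`a_J = a_K = 0`, `r = a_I > 0`, `‖a‖ ≤ 1`) and `0 < s ≤ 1`,
`(vol ⊗ vol)(G_s(a) Δ G₀(a)) ≤ (√s / r⁶)·K`, `K = 64 + 4√2·Ising(¼)² < ∞`. [folklore] -/
theorem volume_symmDiff_rescaledSet_le {a : ℍ} (hJ : a.imJ = 0) (hK : a.imK = 0) (hr : 0 < a.imI) (ha1 : ‖a‖ ≤ 1)
    {s : ℝ} (hs0 : 0 < s) (hs1 : s ≤ 1) :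
    ((volume : Measure ℍ).prod (volume : Measure ℍ))
        {z : ℍ × ℍ | (z ∈ rescaledSet s a ∧ z ∉ rescaledSet 0 a) ∨ (z ∈ rescaledSet 0 a ∧ z ∉ rescaledSet s a)} ≤
      ENNReal.ofReal (Real.sqrt s / a.imI ^ 6) * (ENNReal.ofReal 64 + ENNReal.ofReal (4 * Real.sqrt 2) * (Ising (1/4) * Ising (1/4))) := by
  have hr1 : a.imI ≤ 1 := by
    have hnorm : a.imI ^ 2 ≤ ‖a‖ ^ 2 := by rw [sq_norm_eq_sum_sq]; nlinarith [sq_nonneg a.re, sq_nonneg a.imJ, sq_nonneg a.imK]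
    nlinarith [norm_nonneg a]
  set U : Set ((ℝ × ℝ) × ((ℝ × ℝ) × ((ℝ × ℝ) × (ℝ × ℝ)))) :=
    layerBX a.imI s ∪ layerHX a.imI ‖a‖ s ∪ layerBY a.imI s ∪ layerHY a.imI ‖a‖ s ∪ layerC a.imI s ∪
      {p | p.1.2 ^ 2 + p.2.1.2 ^ 2 = 0} with hU
  have hUm : MeasurableSet U := by
    have hn : MeasurableSet {p : (ℝ × ℝ) × ((ℝ × ℝ) × ((ℝ × ℝ) × (ℝ × ℝ))) | p.1.2 ^ 2 + p.2.1.2 ^ 2 = 0} :=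
      measurableSet_eq_fun (by fun_prop) measurable_const
    exact (((((measurableSet_layerBX _ _).union (measurableSet_layerHX _ _ _)).union (measurableSet_layerBY _ _)).union
      (measurableSet_layerHY _ _ _)).union (measurableSet_layerC _ _)).union hn
  have hsub : {z : ℍ × ℍ | (z ∈ rescaledSet s a ∧ z ∉ rescaledSet 0 a) ∨ (z ∈ rescaledSet 0 a ∧ z ∉ rescaledSet s a)} ⊆ pairCoord ⁻¹' U := by
    rintro ⟨x, y⟩ hz
    exact pairCoord_mem_layers hJ hK hr ha1 hs0 hs1 hz
  obtain ⟨v1, v2, v3, v4⟩ := volume_layers_BH_le (ρ := ‖a‖) hr hs0.le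
  calc ((volume : Measure ℍ).prod (volume : Measure ℍ))
        {z : ℍ × ℍ | (z ∈ rescaledSet s a ∧ z ∉ rescaledSet 0 a) ∨ (z ∈ rescaledSet 0 a ∧ z ∉ rescaledSet s a)}
      ≤ ((volume : Measure ℍ).prod (volume : Measure ℍ)) (pairCoord ⁻¹' U) := measure_mono hsub
    _ = volume U := measurePreserving_pairCoord.measure_preimage hUm.nullMeasurableSet
    _ ≤ volume (layerBX a.imI s) + volume (layerHX a.imI ‖a‖ s) + volume (layerBY a.imI s) + volume (layerHY a.imI ‖a‖ s) +
          volume (layerC a.imI s) + volume {p : (ℝ × ℝ) × ((ℝ × ℝ) × ((ℝ × ℝ) × (ℝ × ℝ))) | p.1.2 ^ 2 + p.2.1.2 ^ 2 = 0} := by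
        rw [hU]
        refine (measure_union_le _ _).trans (add_le_add ?_ le_rfl)
        refine (measure_union_le _ _).trans (add_le_add ?_ le_rfl)
        refine (measure_union_le _ _).trans (add_le_add ?_ le_rfl)
        refine (measure_union_le _ _).trans (add_le_add ?_ le_rfl)
        exact measure_union_le _ _
    _ ≤ 4 * (ENNReal.ofReal (2 * Real.sqrt s / a.imI) * ENNReal.ofReal (8 / a.imI ^ 4)) +
          ENNReal.ofReal (2 * Real.sqrt 2 * Real.sqrt s / a.imI ^ 2) * (Ising (1/4) * ((2 * Ising (1/4)) * ENNReal.ofReal (1 / a.imI ^ 4))) := by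
        rw [volume_nullPiece, add_zero]
        have hc := volume_layerC_le hr hs0
        calc volume (layerBX a.imI s) + volume (layerHX a.imI ‖a‖ s) + volume (layerBY a.imI s) + volume (layerHY a.imI ‖a‖ s) + volume (layerC a.imI s)
            ≤ ENNReal.ofReal (2 * Real.sqrt s / a.imI) * ENNReal.ofReal (8 / a.imI ^ 4) + ENNReal.ofReal (2 * Real.sqrt s / a.imI) * ENNReal.ofReal (8 / a.imI ^ 4) +
              ENNReal.ofReal (2 * Real.sqrt s / a.imI) * ENNReal.ofReal (8 / a.imI ^ 4) + ENNReal.ofReal (2 * Real.sqrt s / a.imI) * ENNReal.ofReal (8 / a.imI ^ 4) +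
              ENNReal.ofReal (2 * Real.sqrt 2 * Real.sqrt s / a.imI ^ 2) * (Ising (1/4) * ((2 * Ising (1/4)) * ENNReal.ofReal (1 / a.imI ^ 4))) := by
                gcongr
          _ = _ := by ring
    _ ≤ _ := layer_sum_le hr hr1 (Ising (1/4))

end Summit.QuantumFields.YangMills.Theorems.SwapVirialDeficit.ZeroModeGroup

end
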